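import Literature.AlgebraicGeometry.Motives.HodgeStructureLefschetzGroupDirectSumLifting
import Literature.AlgebraicGeometry.Motives.HodgeStructureGraphClassGysinFormula
import Literature.AlgebraicGeometry.Motives.HodgeStructureLefschetzCorrespondenceComposition
import HarnessLib

/-!
# Milne 1999, Prop. 5.7 (second statement), Cor. 5.5 and the closure of Lefschetz correspondences under composition —
# UNCONDITIONALLY, for arbitrary polarized `ℚ`-Hodge structures `H₁`, `H₂`, `H₃` of odd weight

[topic AlgebraicGeometry/Motives]

Layer `Literature/AlgebraicGeometry/Motives`, lane `lit-hodgefound` (Track 2 foundations library; prover seat `lit-hodgefound-p34`,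
generation 34, row g34-#4). THEOREMS ONLY (no `def`, no named fact, no instance, no notation; net debt `0`). Rows g32-#3
(`Polarization.corrMap_apply_mem_adjoin_hodgeClasses_two`, `Motives/HodgeStructureCorrespondencesLefschetzGroup`), g32-#6
(`Polarization.pushforward_apply_mem_adjoin_hodgeClasses_two`, `Motives/HodgeStructurePushforwardGraphLefschetz`), g32-#7
(`Polarization.corrMap_apply_mem_map_divisorClasses`, `Polarization.pushforward_apply_mem_map_divisorClasses`,
`Motives/HodgeStructureGraphClassGysinFormula`) and g33-#5 (`Polarization.corrComp_mem_adjoin_hodgeClasses_two`,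
`Polarization.corrComp_mem_map_divisorClasses`, `Motives/HodgeStructureLefschetzCorrespondenceComposition`) prove Milne's
statements for a pair / triple of polarized Hodge structures UNDER the lifting hypotheses `hsurj` ("every `γ₂ ∈ S(H₂)(ℂ)` lifts to
`γ₁ ⊕ γ₂ ∈ S(H₁ ⊕ H₂)(ℂ)`") resp. `hlift` (three summands) — Milne's "`L(A)` is canonically a quotient `L → L(A)` of `L`" (p. 663).
Row g34-#3 (`Motives/HodgeStructureLefschetzGroupDirectSumLifting`) PROVES these hypotheses for every field `K ⊇ ℚ`
(`Polarization.exists_blockDiag_mem_lefschetzGroupBaseChange_prod`, `Polarization.exists_blockDiag_mem_and_blockDiag_mem_of_blockDiag_mem`);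
this file records the discharged hypotheses (§0) and the resulting UNCONDITIONAL statements (§1–§3). NAMING: the primed name
`X'` is the statement of row `X` with the hypothesis `hsurj`/`hlift` removed (the polarization of the other summand(s) stays as an
explicit hypothesis); nothing of the earlier rows is renamed or restated otherwise.

## Source, VERBATIM

J. S. Milne, *Lefschetz classes on abelian varieties*, Duke Math. J. 96 (1999) [Milne1999LefschetzClasses] (held
`paper:doi-10-1215-s0012-7094-99-09620-5`, author's folios; Duke page = folio + 638): folio 25 (p. 663) "For an abelian variety `A`
whose simple isogeny factors lie in `T`, `L(A)` is canonically a quotient `L → L(A)` of `L`"; "**Corollary 5.5.** For any regular map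
`φ : A → B` of abelian varieties, `φ_*` maps Lefschetz classes on `A` to Lefschetz classes on `B`. Proof. Because `φ_*` commutes with
the actions of `L(A × B)`, it maps classes fixed by `L(A)` to classes fixed by `L(B)`, and we can apply Corollary 4.5."; folio 26
(p. 664) "**Proposition 5.7.** Let `A` and `B` be abelian varieties over `Ω`. A cohomological correspondence `u` between `A` and `B`
is Lefschetz if and only if `ū : H*(A) → H*(B)` commutes with the actions of `L(A × B)`. If `u` is Lefschetz, then `ū` maps `D(A)_k`
into `D(B)_k`."

## What is PROVED (odd weight `n`, `dim Vᵢ = 2gᵢ`, `ℚ[B¹(H)] = Algebra.adjoin ℚ (Hodge classes of ⋀²H)`, `D^p(H) = H.divisorClasses p`)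

* §0 the lifting hypotheses at every field `K ⊇ ℚ`, in the exact shapes `hsurj`, `hlift` of the rows above
  (`Polarization.forall_exists_blockDiag_mem_lefschetzGroupBaseChange_prod`,
  `Polarization.forall_exists_blockDiag_mem_and_blockDiag_mem`).
* §1 **Prop. 5.7, second statement** (`Polarization.corrMap_apply_mem_adjoin_hodgeClasses_two'`: `u ∈ ℚ[B¹(H₁ ⊕ H₂)]`,
  `x ∈ ℚ[B¹(H₁)]` ⟹ `ū x ∈ ℚ[B¹(H₂)]`) and its graded form (`Polarization.corrMap_apply_mem_map_divisorClasses'`: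
  `u ∈ D^k(H₁ ⊕ H₂)`, `x ∈ D^p(H₁)`, `p + k = g₁ + q` ⟹ `ū x ∈ D^q(H₂)`).
* §2 **Cor. 5.5** (`Polarization.pushforward_apply_mem_adjoin_hodgeClasses_two'`: `φ_* ℚ[B¹(H₁)] ⊆ ℚ[B¹(H₂)]` for a morphism
  `f = φ^*|H¹ : H₂ → H₁`) and its graded form (`Polarization.pushforward_apply_mem_map_divisorClasses'`: `φ_* D^p(H₁) ⊆ D^q(H₂)`,
  `p + g₂ = g₁ + q`).
* §3 **Lefschetz correspondences are closed under composition** (`Polarization.corrComp_mem_adjoin_hodgeClasses_two'`: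
  `u ∈ ℚ[B¹(H₁ ⊕ H₂)]`, `v ∈ ℚ[B¹(H₂ ⊕ H₃)]` ⟹ `v ∘ u ∈ ℚ[B¹(H₁ ⊕ H₃)]`) and the graded form
  (`Polarization.corrComp_mem_map_divisorClasses'`: `D^l(H₂ ⊕ H₃) ∘ D^k(H₁ ⊕ H₂) ⊆ D^m(H₁ ⊕ H₃)`, `k + l = g₂ + m`).

## References

* [Milne1999LefschetzClasses] J. S. Milne, *Lefschetz classes on abelian varieties*, Duke Math. J. 96 (1999), §5 p. 663 (Prop. 5.4,
  Cor. 5.5), Prop. 5.7 (p. 664), Prop. 5.1 (p. 662); §1 Prop. 1.5 (p. 644).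
* [Fulton1998] W. Fulton, *Intersection Theory*, 2nd ed. (1998), §16.1 (composition of correspondences).
-/

open scoped TensorProduct

namespace Literature.AlgebraicGeometry.Motives

namespace HodgeStructure

open ExteriorLefschetz ExteriorAlgebra

universe u uK

/-! ## §0 The lifting hypotheses, discharged -/

section Lifting

variable (K : Type uK) [Field K] [Algebra ℚ K] {V₁ V₂ V₃ : Type u} [AddCommGroup V₁] [Module ℚ V₁] [Module.Finite ℚ V₁]
  [AddCommGroup V₂] [Module ℚ V₂] [Module.Finite ℚ V₂] [AddCommGroup V₃] [Module ℚ V₃] [Module.Finite ℚ V₃] {n : ℤ}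
  {H₁ : HodgeStructure V₁ n} {H₂ : HodgeStructure V₂ n} {H₃ : HodgeStructure V₃ n}
  (Q₁ : Polarization H₁) (Q₂ : Polarization H₂) (Q₃ : Polarization H₃)

/-- **The hypothesis `hsurj` of rows g32-#3/#6/#7 holds** (every field `K ⊇ ℚ`): every `γ₂ ∈ S(H₂)(K)` lifts to a block-diagonal
`γ₁ ⊕ γ₂ ∈ S(H₁ ⊕ H₂)(K)` — row g34-#3 `Polarization.exists_blockDiag_mem_lefschetzGroupBaseChange_prod`, forgetting `γ₁ ∈ S(H₁)(K)`.
[cite: Milne1999LefschetzClasses, §5 p. 663 ("L(A) is canonically a quotient L → L(A) of L") and §1 Prop. 1.5 (p. 644)] -/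
theorem Polarization.forall_exists_blockDiag_mem_lefschetzGroupBaseChange_prod :
    ∀ γ₂ ∈ Q₂.lefschetzGroupBaseChange K, ∃ γ₁ : (K ⊗[ℚ] V₁) ≃ₗ[K] (K ⊗[ℚ] V₁),
      blockDiag K V₁ V₂ (γ₁, γ₂) ∈ (Q₁.prod Q₂).lefschetzGroupBaseChange K := fun _ hγ₂ ↦
  (Q₁.exists_blockDiag_mem_lefschetzGroupBaseChange_prod K Q₂ hγ₂).imp fun _ h ↦ h.2

/-- **The hypothesis `hlift` of row g33-#5 holds** (every field `K ⊇ ℚ`): every `γ₁ ⊕ γ₃ ∈ S(H₁ ⊕ H₃)(K)` admits `γ₂` with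
`γ₁ ⊕ γ₂ ∈ S(H₁ ⊕ H₂)(K)` and `γ₂ ⊕ γ₃ ∈ S(H₂ ⊕ H₃)(K)` — row g34-#3 `Polarization.exists_blockDiag_mem_and_blockDiag_mem_of_blockDiag_mem`,
forgetting `γ₂ ∈ S(H₂)(K)`. [cite: Milne1999LefschetzClasses, §5 p. 663 and p. 665 (proof of Prop. 5.7), §1 Prop. 1.5 (p. 644)] -/
theorem Polarization.forall_exists_blockDiag_mem_and_blockDiag_mem :
    ∀ (γ₁ : (K ⊗[ℚ] V₁) ≃ₗ[K] (K ⊗[ℚ] V₁)) (γ₃ : (K ⊗[ℚ] V₃) ≃ₗ[K] (K ⊗[ℚ] V₃)),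
      blockDiag K V₁ V₃ (γ₁, γ₃) ∈ (Q₁.prod Q₃).lefschetzGroupBaseChange K →
        ∃ γ₂ : (K ⊗[ℚ] V₂) ≃ₗ[K] (K ⊗[ℚ] V₂), blockDiag K V₁ V₂ (γ₁, γ₂) ∈ (Q₁.prod Q₂).lefschetzGroupBaseChange K ∧
          blockDiag K V₂ V₃ (γ₂, γ₃) ∈ (Q₂.prod Q₃).lefschetzGroupBaseChange K := fun _ _ hγ ↦
  (Q₁.exists_blockDiag_mem_and_blockDiag_mem_of_blockDiag_mem K Q₂ Q₃ hγ).imp fun _ h ↦ h.2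

end Lifting

section Pair

variable {V₁ V₂ : Type u} [AddCommGroup V₁] [Module ℚ V₁] [Module.Finite ℚ V₁] [AddCommGroup V₂] [Module ℚ V₂] [Module.Finite ℚ V₂]
  {n : ℤ} {H₁ : HodgeStructure V₁ n} {H₂ : HodgeStructure V₂ n} (Q₁ : Polarization H₁) (Q₂ : Polarization H₂) (hn : Odd n)
  {g₁ g₂ : ℕ} (hg₁ : Module.finrank ℚ V₁ = 2 * g₁) (hg₂ : Module.finrank ℚ V₂ = 2 * g₂)

/-! ## §1 Prop. 5.7, second statement: a Lefschetz correspondence maps Lefschetz classes to Lefschetz classes -/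

include Q₂ hn hg₁ in
/-- **MILNE 1999, PROP. 5.7, SECOND STATEMENT — "If `u` is Lefschetz, then `ū` maps `D(A)_k` into `D(B)_k`" — UNCONDITIONALLY, for
arbitrary polarized `H₁`, `H₂`**: for `u ∈ ℚ[B¹(H₁ ⊕ H₂)]` and `x ∈ ℚ[B¹(H₁)]`, `ū x ∈ ℚ[B¹(H₂)]` (row g32-#3 with its lifting
hypothesis discharged by §0 at `K = ℂ`; `Q₂` = a polarization of the target). [cite: Milne1999LefschetzClasses, §5 Prop. 5.7 (p. 664) and p. 663]
[cite: Milne1999LefschetzClasses, §4 Cor. 4.5 (p. 659)] -/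
theorem Polarization.corrMap_apply_mem_adjoin_hodgeClasses_two' {u : ExteriorAlgebra ℚ (V₁ × V₂)}
    (hu : u ∈ Algebra.adjoin ℚ ((((H₁.prod H₂).exteriorPower 2).hodgeClasses n).map (⋀[ℚ]^2 (V₁ × V₂)).subtype :
      Set (ExteriorAlgebra ℚ (V₁ × V₂))))
    {x : ExteriorAlgebra ℚ V₁}
    (hx : x ∈ Algebra.adjoin ℚ (((H₁.exteriorPower 2).hodgeClasses n).map (⋀[ℚ]^2 V₁).subtype : Set (ExteriorAlgebra ℚ V₁))) :
    corrMap (Q₁.lefschetzClass : ExteriorAlgebra ℚ V₁) g₁ u x ∈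
      Algebra.adjoin ℚ (((H₂.exteriorPower 2).hodgeClasses n).map (⋀[ℚ]^2 V₂).subtype : Set (ExteriorAlgebra ℚ V₂)) :=
  Q₁.corrMap_apply_mem_adjoin_hodgeClasses_two Q₂ hn hg₁ (Q₁.forall_exists_blockDiag_mem_lefschetzGroupBaseChange_prod ℂ Q₂) hu hx

include Q₂ hn hg₁ in
/-- **PROP. 5.7, SECOND STATEMENT, GRADED — UNCONDITIONALLY: a Lefschetz class `u ∈ D^k(H₁ ⊕ H₂)` maps `D^p(H₁)` into `D^q(H₂)`,
`p + k = g₁ + q`** ("`ū : Hⁱ → H^{i+2s−2d}`", `2s = 2k`, `d = g₁`; row g32-#7 with `hsurj` discharged).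
[cite: Milne1999LefschetzClasses, §5 Prop. 5.7 (p. 664), Prop. 5.1 (p. 662)] -/
theorem Polarization.corrMap_apply_mem_map_divisorClasses' {k : ℕ} {u : ExteriorAlgebra ℚ (V₁ × V₂)}
    (hu : u ∈ ((H₁.prod H₂).divisorClasses k).map (⋀[ℚ]^(2 * k) (V₁ × V₂)).subtype) {p q : ℕ} (hpq : p + k = g₁ + q)
    {x : ExteriorAlgebra ℚ V₁} (hx : x ∈ (H₁.divisorClasses p).map (⋀[ℚ]^(2 * p) V₁).subtype) :
    corrMap (Q₁.lefschetzClass : ExteriorAlgebra ℚ V₁) g₁ u x ∈ (H₂.divisorClasses q).map (⋀[ℚ]^(2 * q) V₂).subtype :=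
  Q₁.corrMap_apply_mem_map_divisorClasses Q₂ hn hg₁ (Q₁.forall_exists_blockDiag_mem_lefschetzGroupBaseChange_prod ℂ Q₂) hu hpq hx

/-! ## §2 Cor. 5.5: `φ_*` maps Lefschetz classes to Lefschetz classes -/

include hn hg₁ in
/-- **MILNE 1999, COR. 5.5 — "For any regular map `φ : A → B` of abelian varieties, `φ_*` maps Lefschetz classes on `A` to
Lefschetz classes on `B`" — UNCONDITIONALLY, for arbitrary polarized `H₁`, `H₂`**: with `f = φ^*|H¹ : H₂ → H₁` and the Gysin map
`φ_* = pushforward` of row g32-#6 (orientations `τ_{E_{Q₁}}`, `τ_{E_{Q₂}}`), `x ∈ ℚ[B¹(H₁)] ⟹ φ_* x ∈ ℚ[B¹(H₂)]` (row g32-#6 with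
`hsurj` discharged). [cite: Milne1999LefschetzClasses, §5 Cor. 5.5 (p. 663) and §4 Cor. 4.5 (p. 659)] -/
theorem Polarization.pushforward_apply_mem_adjoin_hodgeClasses_two' (f : Hom H₂ H₁) {x : ExteriorAlgebra ℚ V₁}
    (hx : x ∈ Algebra.adjoin ℚ (((H₁.exteriorPower 2).hodgeClasses n).map (⋀[ℚ]^2 V₁).subtype : Set (ExteriorAlgebra ℚ V₁))) :
    (Q₂.isSymplectic_lefschetzClass hn hg₂).pushforward (Q₁.lefschetzClass : ExteriorAlgebra ℚ V₁) g₁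
        (ExteriorAlgebra.map f.toLinearMap).toLinearMap x ∈
      Algebra.adjoin ℚ (((H₂.exteriorPower 2).hodgeClasses n).map (⋀[ℚ]^2 V₂).subtype : Set (ExteriorAlgebra ℚ V₂)) :=
  Q₁.pushforward_apply_mem_adjoin_hodgeClasses_two Q₂ hn hg₁ hg₂
    (Q₁.forall_exists_blockDiag_mem_lefschetzGroupBaseChange_prod ℂ Q₂) f hx

include hn hg₁ in
/-- **COR. 5.5, GRADED — UNCONDITIONALLY: `φ_* D^p(H₁) ⊆ D^q(H₂)` for `p + g₂ = g₁ + q`** ("`φ_* : H^{2s}(A)(s) → H^{2s+2c}(B)(s + c)`";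
row g32-#7 with `hsurj` discharged). [cite: Milne1999LefschetzClasses, §5 Prop. 5.4 and Cor. 5.5 (p. 663), Prop. 5.1 (p. 662)] -/
theorem Polarization.pushforward_apply_mem_map_divisorClasses' (f : Hom H₂ H₁) {p q : ℕ} (hpq : p + g₂ = g₁ + q)
    {x : ExteriorAlgebra ℚ V₁} (hx : x ∈ (H₁.divisorClasses p).map (⋀[ℚ]^(2 * p) V₁).subtype) :
    (Q₂.isSymplectic_lefschetzClass hn hg₂).pushforward (Q₁.lefschetzClass : ExteriorAlgebra ℚ V₁) g₁
        (ExteriorAlgebra.map f.toLinearMap).toLinearMap x ∈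
      (H₂.divisorClasses q).map (⋀[ℚ]^(2 * q) V₂).subtype :=
  Q₁.pushforward_apply_mem_map_divisorClasses Q₂ hn hg₁ hg₂ (Q₁.forall_exists_blockDiag_mem_lefschetzGroupBaseChange_prod ℂ Q₂)
    f hpq hx

end Pair

/-! ## §3 Lefschetz correspondences are closed under composition -/

section Triple

variable {V₁ V₂ V₃ : Type u} [AddCommGroup V₁] [Module ℚ V₁] [Module.Finite ℚ V₁] [AddCommGroup V₂] [Module ℚ V₂] [Module.Finite ℚ V₂]
  [AddCommGroup V₃] [Module ℚ V₃] [Module.Finite ℚ V₃] {n : ℤ} {H₁ : HodgeStructure V₁ n} {H₂ : HodgeStructure V₂ n}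
  {H₃ : HodgeStructure V₃ n} (Q₁ : Polarization H₁) (Q₂ : Polarization H₂) (Q₃ : Polarization H₃) (hn : Odd n) {g₁ g₂ : ℕ}
  (hg₁ : Module.finrank ℚ V₁ = 2 * g₁) (hg₂ : Module.finrank ℚ V₂ = 2 * g₂)

include Q₁ Q₃ hn hg₁ hg₂ in
/-- **LEFSCHETZ CORRESPONDENCES ARE CLOSED UNDER COMPOSITION — UNCONDITIONALLY, for arbitrary polarized `H₁`, `H₂`, `H₃`**: for
`u ∈ ℚ[B¹(H₁ ⊕ H₂)]` and `v ∈ ℚ[B¹(H₂ ⊕ H₃)]` the composite `v ∘ u` (row g33-#1 `corrComp`, orientation `τ_{E₂}` on the middle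
factor) lies in `ℚ[B¹(H₁ ⊕ H₃)]` — row g33-#5 with its lifting hypothesis `hlift` discharged by §0 at `K = ℂ` (`Q₁`, `Q₃` =
polarizations of `H₁`, `H₃`). [cite: Milne1999LefschetzClasses, §5 Prop. 5.7 (p. 664), p. 663 and p. 665] [cite: Fulton1998, §16.1 Cor. 16.1.2 and Remark 16.1 (iii)] -/
theorem Polarization.corrComp_mem_adjoin_hodgeClasses_two' {u : ExteriorAlgebra ℚ (V₁ × V₂)}
    (hu : u ∈ Algebra.adjoin ℚ ((((H₁.prod H₂).exteriorPower 2).hodgeClasses n).map (⋀[ℚ]^2 (V₁ × V₂)).subtype :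
      Set (ExteriorAlgebra ℚ (V₁ × V₂))))
    {v : ExteriorAlgebra ℚ (V₂ × V₃)}
    (hv : v ∈ Algebra.adjoin ℚ ((((H₂.prod H₃).exteriorPower 2).hodgeClasses n).map (⋀[ℚ]^2 (V₂ × V₃)).subtype :
      Set (ExteriorAlgebra ℚ (V₂ × V₃)))) :
    corrComp (Q₂.lefschetzClass : ExteriorAlgebra ℚ V₂) g₂ v u ∈
      Algebra.adjoin ℚ ((((H₁.prod H₃).exteriorPower 2).hodgeClasses n).map (⋀[ℚ]^2 (V₁ × V₃)).subtype :
        Set (ExteriorAlgebra ℚ (V₁ × V₃))) :=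
  Q₁.corrComp_mem_adjoin_hodgeClasses_two Q₂ Q₃ hn hg₁ hg₂ (Q₁.forall_exists_blockDiag_mem_and_blockDiag_mem ℂ Q₂ Q₃) hu hv

include Q₁ Q₃ hn hg₁ hg₂ in
/-- **GRADED FORM — UNCONDITIONALLY: `u ∈ D^k(H₁ ⊕ H₂)`, `v ∈ D^l(H₂ ⊕ H₃)`, `k + l = g₂ + m` ⟹ `v ∘ u ∈ D^m(H₁ ⊕ H₃)`** ("if `α` has
degree `p`, and `β` has degree `q`, then `β ∘ α` has degree `p + q`"; row g33-#5 with `hlift` discharged).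
[cite: Milne1999LefschetzClasses, §5 Prop. 5.1 (p. 662), Prop. 5.7 (p. 664)] [cite: Fulton1998, §16.1 Example 16.1.1] -/
theorem Polarization.corrComp_mem_map_divisorClasses' {k l m : ℕ} (hklm : k + l = g₂ + m)
    {u : ExteriorAlgebra ℚ (V₁ × V₂)} (hu : u ∈ ((H₁.prod H₂).divisorClasses k).map (⋀[ℚ]^(2 * k) (V₁ × V₂)).subtype)
    {v : ExteriorAlgebra ℚ (V₂ × V₃)} (hv : v ∈ ((H₂.prod H₃).divisorClasses l).map (⋀[ℚ]^(2 * l) (V₂ × V₃)).subtype) :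
    corrComp (Q₂.lefschetzClass : ExteriorAlgebra ℚ V₂) g₂ v u ∈ ((H₁.prod H₃).divisorClasses m).map (⋀[ℚ]^(2 * m) (V₁ × V₃)).subtype :=
  Q₁.corrComp_mem_map_divisorClasses Q₂ Q₃ hn hg₁ hg₂ (Q₁.forall_exists_blockDiag_mem_and_blockDiag_mem ℂ Q₂ Q₃) hklm hu hv

end Triple

end HodgeStructure

end Literature.AlgebraicGeometry.Motives
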